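import Summits.BirchSwinnertonDyer.BirchSwinnertonDyer.Theorems.AdditiveKolyvaginRoadKuriharaPrimeSupply
import Summits.BirchSwinnertonDyer.BirchSwinnertonDyer.Theorems.AdditiveKolyvaginRoadKuriharaDiscreteLogSupply
import HarnessLib

/-!
# Route `AdditiveKolyvaginRoad`, crux KS′ `LevelKolyvaginSystemsAdditive` (item stmt-BirchSwinnertonDyer-21396): the Kurihara clause of crux
# card `kurihara-lower-half` REDUCES TO ITS UNIT CONJUNCT — levels and discrete-log systems exist simultaneously, for every curve
# (sequel of `…KuriharaPrimeSupply.lean` p649531 and `…KuriharaDiscreteLogSupply.lean` p650882; cell `pub/bsd-wall`, width seat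
# `bsd-wall-akr-p2x-w4` g6; `--supports stmt-BirchSwinnertonDyer-21396`, helper)

THEOREMS ONLY (no definition, no named fact, no `sorry`).  BSD is not proved by any of this; nothing about Kurihara NUMBERS is claimed.

The sketch's clause (`RamifiedHabitatKuriharaSlotSketch.lean` §2) is `∃ n g dl, IsKuriharaLevel W p n ∧ IsDiscreteLogSystem n g dl ∧ δ_n ≠ 0 ∧
ord_p δ_n = 0`.  This file records, BY NAME over the two supply files, that the first two conjuncts are JOINTLY satisfiable for every globally
minimal elliptic `W/ℚ`, every prime `p`, with any prescribed number `k ≥ 1` of prime factors all above any bound `b`: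

* `exists_kuriharaLevel_and_discreteLogSystem` — `∃ n g dl, (IsKuriharaLevel W p n, unfolded) ∧ (IsDiscreteLogSystem n g dl, unfolded) ∧
  #primeFactors n = k ∧ every prime factor > b`.

So C⁺ (`KuriharaNonvanishingRankZeroAdditive`) is, row by row, exactly the statement that SOME such `(n, g, dl)` has a `p`-adic unit Kurihara
number. [cite: KimNakamura2020, §1.2, Rem. 1.8]
-/

-- single-conjunct summit: `Summit.BirchSwinnertonDyer.BirchSwinnertonDyer.…` repeats the name by design
set_option linter.dupNamespace false
set_option autoImplicit false

noncomputable section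

namespace Summit.BirchSwinnertonDyer.BirchSwinnertonDyer.Theorems.AdditiveKoly.KuriharaRoad

open WeierstrassCurve

/-- **Kurihara levels AND discrete-log systems, simultaneously, for every curve.**  For `W/ℚ` elliptic in global minimal form, a prime `p`,
`k ≥ 1` and a bound `b`: there are `n`, `g`, `dl` with `n` a Kurihara level of `(W, p)` (square-free, `> 1`, every prime factor `ℓ` has
`ℓ ∤ N_W`, `ℓ ≠ p`, `p ∣ ℓ − 1`, `p ∣ a_ℓ − (ℓ+1)`), `(g, dl)` a discrete-log system for `n` (primitive roots and logarithms modulo the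
primes of `n`), `n` with exactly `k` prime factors, all `> b`.  `= exists_kuriharaLevel_card_eq` + `exists_isDiscreteLogSystem`.
[cite: KimNakamura2020, §1.2 (Kurihara primes and numbers)] -/
theorem exists_kuriharaLevel_and_discreteLogSystem (W : WeierstrassCurve ℚ) [W.IsElliptic] [W.IsGloballyMinimal]
    (p : ℕ) [Fact p.Prime] (k : ℕ) (hk : 1 ≤ k) (b : ℕ) :
    ∃ (n : ℕ) (g : ℕ → ℕ) (dl : ℕ → ℕ → ℕ),
      (Squarefree n ∧ 1 < n ∧ ∀ ℓ ∈ n.primeFactors,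
        ¬ (ℓ : ℤ) ∣ (W.conductorNorm ℤ : ℤ) ∧ ℓ ≠ p ∧ p ∣ ℓ - 1 ∧ (p : ℤ) ∣ W.frobeniusTrace ℓ - (ℓ + 1)) ∧
      (∀ ℓ ∈ n.primeFactors, IsPrimitiveRoot (g ℓ : ZMod ℓ) (ℓ - 1) ∧
        ∀ a : ℕ, Nat.Coprime a n → (g ℓ : ZMod ℓ) ^ (dl ℓ a) = (a : ZMod ℓ)) ∧
      n.primeFactors.card = k ∧ (∀ ℓ ∈ n.primeFactors, b < ℓ) := by
  obtain ⟨n, hcard, hbig, hlevel⟩ := exists_kuriharaLevel_card_eq W p k hk b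
  obtain ⟨g, dl, hdl⟩ := exists_isDiscreteLogSystem n
  exact ⟨n, g, dl, hlevel, hdl, hcard, hbig⟩

end Summit.BirchSwinnertonDyer.BirchSwinnertonDyer.Theorems.AdditiveKoly.KuriharaRoad

end
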